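import Mathlib
import HarnessLib

/-!
# Summation by parts on a finite abelian group (torus calculus for the optimal Bogoliubov test form)

Route-independent elementary identities (no `Theses` import) used by `U1DipoleHelicityOptimalTestForm`
(parity-free lower half of the crux stmt-QuantumFields-25881 of the abelian comparison line
`U1DipoleHelicity`, LINE 4 of the ideator cell ym-idea-2; not a rung of `YangMills`): translation
invariance of finite sums over a finite abelian group `G` (the discrete torus `(ℤ/Lℤ)⁴`), the
`ℓ²`-identity `Σ_y (h(y+s) − h(y))² = Σ_y h·(−Δ_s h)`, adjointness of the second difference, the
back-difference identity `Σ_y (∇⁻_s g)(∇⁻_s u) = Σ_y g·(−Δ_s u)`, the vanishing of `Σ_y (−Δ_s u)(y)`,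
and the mixed-plane norm identity `Σ_y (∇⁺_t ∇⁻_s g)² = Σ_y (−Δ_s g)(−Δ_t g)`.

Nothing here bears on the Yang–Mills mass gap.
-/

noncomputable section

namespace Summit.QuantumFields.YangMills.Theorems.U1DipoleHelicity

open Finset

/-! ### Summation by parts on a finite abelian group -/

section SBP

variable {G : Type*} [AddCommGroup G] [Fintype G]

/-- Translation invariance of finite sums: `Σ_y F(y + s) = Σ_y F(y)`. [folklore] -/
theorem sum_add_shift (F : G → ℝ) (s : G) : ∑ y, F (y + s) = ∑ y, F y :=
  Fintype.sum_equiv (Equiv.addRight s) _ _ fun y => by rw [Equiv.coe_addRight]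

/-- Translation invariance of finite sums: `Σ_y F(y − s) = Σ_y F(y)`. [folklore] -/
theorem sum_sub_shift (F : G → ℝ) (s : G) : ∑ y, F (y - s) = ∑ y, F y :=
  Fintype.sum_equiv (Equiv.addRight (-s)) _ _ fun y => by rw [Equiv.coe_addRight, sub_eq_add_neg]

/-- `Σ_y (h(y+s) − h(y))² = Σ_y h(y)·(2h(y) − h(y+s) − h(y−s))`. [folklore] -/
theorem sum_sq_sub_shift (h : G → ℝ) (s : G) :
    ∑ y, (h (y + s) - h y) ^ 2 = ∑ y, h y * (2 * h y - h (y + s) - h (y - s)) := by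
  have e1 : ∑ y, (h (y + s) - h y) ^ 2 =
      ∑ y, h (y + s) ^ 2 - 2 * ∑ y, h y * h (y + s) + ∑ y, h y ^ 2 := by
    rw [Finset.mul_sum, ← Finset.sum_sub_distrib, ← Finset.sum_add_distrib]
    exact Finset.sum_congr rfl fun y _ => by ring
  have e2 : ∑ y, h y * (2 * h y - h (y + s) - h (y - s)) =
      2 * ∑ y, h y ^ 2 - ∑ y, h y * h (y + s) - ∑ y, h y * h (y - s) := by
    rw [Finset.mul_sum, ← Finset.sum_sub_distrib, ← Finset.sum_sub_distrib]
    exact Finset.sum_congr rfl fun y _ => by ring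
  have e3 : ∑ y, h (y + s) ^ 2 = ∑ y, h y ^ 2 := sum_add_shift (fun y => h y ^ 2) s
  have e4 : ∑ y, h y * h (y - s) = ∑ y, h y * h (y + s) := by
    rw [← sum_add_shift (fun y => h y * h (y - s)) s]
    exact Finset.sum_congr rfl fun y _ => by rw [add_sub_cancel_right, mul_comm]
  rw [e1, e2, e3, e4]
  ring

/-- Adjointness of the second difference: `Σ_y g(y)(2u(y) − u(y+s) − u(y−s)) = Σ_y (2g(y) − g(y+s) − g(y−s)) u(y)`.
[folklore] -/
theorem sum_mul_secondDiff_comm (g u : G → ℝ) (s : G) :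
    ∑ y, g y * (2 * u y - u (y + s) - u (y - s)) = ∑ y, (2 * g y - g (y + s) - g (y - s)) * u y := by
  have e1 : ∑ y, g y * (2 * u y - u (y + s) - u (y - s)) =
      2 * ∑ y, g y * u y - ∑ y, g y * u (y + s) - ∑ y, g y * u (y - s) := by
    rw [Finset.mul_sum, ← Finset.sum_sub_distrib, ← Finset.sum_sub_distrib]
    exact Finset.sum_congr rfl fun y _ => by ring
  have e2 : ∑ y, (2 * g y - g (y + s) - g (y - s)) * u y =
      2 * ∑ y, g y * u y - ∑ y, g (y + s) * u y - ∑ y, g (y - s) * u y := by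
    rw [Finset.mul_sum, ← Finset.sum_sub_distrib, ← Finset.sum_sub_distrib]
    exact Finset.sum_congr rfl fun y _ => by ring
  have e3 : ∑ y, g (y - s) * u y = ∑ y, g y * u (y + s) := by
    rw [← sum_add_shift (fun y => g (y - s) * u y) s]
    exact Finset.sum_congr rfl fun y _ => by rw [add_sub_cancel_right]
  have e4 : ∑ y, g (y + s) * u y = ∑ y, g y * u (y - s) := by
    rw [← sum_sub_shift (fun y => g (y + s) * u y) s]
    exact Finset.sum_congr rfl fun y _ => by rw [sub_add_cancel]
  rw [e1, e2, e3, e4]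
  ring

/-- `Σ_y (g(y) − g(y−s))(u(y) − u(y−s)) = Σ_y g(y)(2u(y) − u(y+s) − u(y−s))`. [folklore] -/
theorem sum_backDiff_mul_backDiff (g u : G → ℝ) (s : G) :
    ∑ y, (g y - g (y - s)) * (u y - u (y - s)) = ∑ y, g y * (2 * u y - u (y + s) - u (y - s)) := by
  have e1 : ∑ y, (g y - g (y - s)) * (u y - u (y - s)) =
      ∑ y, g y * u y - ∑ y, g y * u (y - s) - ∑ y, g (y - s) * u y + ∑ y, g (y - s) * u (y - s) := by
    rw [← Finset.sum_sub_distrib, ← Finset.sum_sub_distrib, ← Finset.sum_add_distrib]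
    exact Finset.sum_congr rfl fun y _ => by ring
  have e2 : ∑ y, g y * (2 * u y - u (y + s) - u (y - s)) =
      2 * ∑ y, g y * u y - ∑ y, g y * u (y + s) - ∑ y, g y * u (y - s) := by
    rw [Finset.mul_sum, ← Finset.sum_sub_distrib, ← Finset.sum_sub_distrib]
    exact Finset.sum_congr rfl fun y _ => by ring
  have e3 : ∑ y, g (y - s) * u y = ∑ y, g y * u (y + s) := by
    rw [← sum_add_shift (fun y => g (y - s) * u y) s]
    exact Finset.sum_congr rfl fun y _ => by rw [add_sub_cancel_right]
  have e4 : ∑ y, g (y - s) * u (y - s) = ∑ y, g y * u y := sum_sub_shift (fun y => g y * u y) s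
  rw [e1, e2, e3, e4]
  ring

/-- The sum of a second difference over the group vanishes. [folklore] -/
theorem sum_secondDiff_eq_zero (u : G → ℝ) (s : G) : ∑ y, (2 * u y - u (y + s) - u (y - s)) = 0 := by
  rw [Finset.sum_sub_distrib, Finset.sum_sub_distrib, ← Finset.mul_sum, sum_add_shift u s, sum_sub_shift u s]
  ring

/-- **The mixed-plane norm identity**: for `h(y) = g(y) − g(y − s)`,
`Σ_y (h(y) − h(y + t))² = Σ_y (2g(y) − g(y+s) − g(y−s))·(2g(y) − g(y+t) − g(y−t))`
(summation by parts twice; shifts commute). [folklore] -/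
theorem sum_sq_backDiff_sub_shift (g : G → ℝ) (s t : G) :
    ∑ y, ((g y - g (y - s)) - (g (y + t) - g (y + t - s))) ^ 2 =
      ∑ y, (2 * g y - g (y + s) - g (y - s)) * (2 * g y - g (y + t) - g (y - t)) := by
  set h : G → ℝ := fun y => g y - g (y - s) with hh
  have e1 : ∑ y, ((g y - g (y - s)) - (g (y + t) - g (y + t - s))) ^ 2 = ∑ y, (h (y + t) - h y) ^ 2 :=
    Finset.sum_congr rfl fun y _ => by simp only [hh]; ring
  rw [e1, sum_sq_sub_shift h t]
  -- `2h(y) − h(y+t) − h(y−t) = u(y) − u(y − s)` with `u = −Δ_t g`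
  have e2 : ∀ y, 2 * h y - h (y + t) - h (y - t) =
      (2 * g y - g (y + t) - g (y - t)) - (2 * g (y - s) - g (y - s + t) - g (y - s - t)) := by
    intro y
    simp only [hh]
    rw [show y + t - s = y - s + t by abel, show y - t - s = y - s - t by abel]
    ring
  simp_rw [e2]
  rw [show (∑ y, h y * ((2 * g y - g (y + t) - g (y - t)) - (2 * g (y - s) - g (y - s + t) - g (y - s - t)))) =
      ∑ y, (g y - g (y - s)) * ((2 * g y - g (y + t) - g (y - t)) -
        (2 * g (y - s) - g (y - s + t) - g (y - s - t))) from rfl]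
  rw [sum_backDiff_mul_backDiff g (fun y => 2 * g y - g (y + t) - g (y - t)) s,
    sum_mul_secondDiff_comm]

end SBP

end Summit.QuantumFields.YangMills.Theorems.U1DipoleHelicity
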